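import Summits.Ventures.PercRepro.ClassVdBHK

/-!
# PercRepro — C-024 at the law level: the class-level statement implies the printed vdBHK theorems (typer-2, gen 6)

`ClassVdBHK.lean` types C-024 (every vdBHK06 Theorem 2.1 / Theorem 1.1 placement on four marks is class-nonnegative).
This file closes the row's sentence «typer-2's LawForm.lean turns each class-level instance into the printed
law-level theorem»: with `rowEvent m h = {ω | h (row4 Π(ω)) = true}` (the event that the row of the marked partition
satisfies `h`) and `sum_bInd_mul_law4` (`E[h]` on the law `= P(rowEvent h)`),

* **`lawForm_kernel21_prob`** / **`lawForm_kernel11_prob`** — the law forms at `p` are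
  `2·(P(fgQ) P(Q) − P(fQ) P(gQ))` resp. `2·(P(AB R_{X∩Y}) P(R_{X∪Y}) − P(A R_X) P(B R_Y))`;
* **`vdBHK21_of_C024Thm21`** — `C024Thm21` gives, for every admissible placement, every finite multigraph, every
  `p ∈ [0,1]^E` and every marks: `P(f ∩ Q) · P(g ∩ Q) ≤ P(f ∩ g ∩ Q) · P(Q)`, i.e. Theorem 2.1 with `q = 1`
  (`E[fg | Q] ≥ E[f | Q] E[g | Q]` after dividing by `P(Q)²`);
* **`vdBHK11_of_C024Thm11`** — `C024Thm11` gives `P(A ∩ R_X) · P(B ∩ R_Y) ≤ P(A ∩ B ∩ R_{X∩Y}) · P(R_{X∪Y})`,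
  i.e. Theorem 1.1;
* `rowEvent_sepRows` / `rowEvent_sepFromRows` read `Q` and `R_X` as the connection events `S ↮ T` / `s ↮ X`, and
  **`C002_event_of_C024Thm21`** spells out the `V3` placement: `P(a ~ b, a ≁ c) · P(c ≁ d, a ≁ c) ≤
  P(a ~ b, c ≁ d, a ≁ c) · P(a ≁ c)` — the C-002 inequality (vdBHK Theorem 1.4), the cell's `C002_holds`.
-/

namespace PercRepro

open Finset

/-- The indicator of a conjunction is the product of the indicators. -/
theorem bInd_and (x y : Bool) : bInd (x && y) = bInd x * bInd y := by
  cases x <;> cases y <;> rfl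

namespace MultiGraph

variable {V E : Type*} (G : MultiGraph V E)

/-- The event «the row of the marked partition of `m` satisfies `h`». -/
def rowEvent (m : Fin 4 → V) (h : Fin 15 → Bool) : Set (Config E) :=
  {ω | h (row4 (G.markedPartition ω m)) = true}

/-- Membership in a row event. -/
theorem mem_rowEvent {m : Fin 4 → V} {h : Fin 15 → Bool} {ω : Config E} :
    ω ∈ G.rowEvent m h ↔ h (row4 (G.markedPartition ω m)) = true := Iff.rfl

open Classical in
/-- **`Q` is the event `S ↮ T`.** -/
theorem rowEvent_sepRows (m : Fin 4 → V) (S T : Finset (Fin 4)) :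
    G.rowEvent m (sepRows S T) = {ω | ∀ i ∈ S, ∀ j ∈ T, ¬ G.Conn ω (m i) (m j)} := by
  ext ω
  simp only [mem_rowEvent, sepRows_row4_markedPartition, decide_eq_true_eq, Set.mem_setOf_eq]

open Classical in
/-- **`R_X` is the event `s ↮ X`.** -/
theorem rowEvent_sepFromRows (m : Fin 4 → V) (s : Fin 4) (X : Finset (Fin 4)) :
    G.rowEvent m (sepFromRows s X) = {ω | ∀ u ∈ X, ¬ G.Conn ω (m s) (m u)} := by
  ext ω
  simp only [mem_rowEvent, sepFromRows_row4_markedPartition, decide_eq_true_eq, Set.mem_setOf_eq]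

open Classical in
/-- **A single literal is the connection event.** -/
theorem rowEvent_rowConn (m : Fin 4 → V) (i j : Fin 4) :
    G.rowEvent m (fun s => rowConn s i j) = G.connEvent (m i) (m j) := by
  ext ω
  simp only [mem_rowEvent, rowConn_row4_markedPartition, decide_eq_true_eq, connEvent,
    Set.mem_setOf_eq]

/-- A conjunction of row predicates is the intersection of the row events. -/
theorem rowEvent_and (m : Fin 4 → V) (h h' : Fin 15 → Bool) :
    G.rowEvent m (fun s => h s && h' s) = G.rowEvent m h ∩ G.rowEvent m h' := by
  ext ω
  simp only [mem_rowEvent, Bool.and_eq_true, Set.mem_inter_iff]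

variable [Fintype E] [DecidableEq E]

/-- **`E[h]` on the law is the probability of the row event**: `Σ_s h(s) π_s = P(rowEvent h)`. -/
theorem sum_bInd_mul_law4 (p : E → ℝ) (a b c d : V) (h : Fin 15 → Bool) :
    ∑ s : Fin 15, ((bInd (h s) : ℤ) : ℝ) * G.law4 p a b c d s =
      prob p (G.rowEvent ![a, b, c, d] h) := by
  classical
  simp only [law4_eq_sum_row, Finset.mul_sum]
  rw [Finset.sum_comm]
  unfold prob
  refine Finset.sum_congr rfl fun ω _ => ?_
  simp only [mul_ite, mul_one, mul_zero, Finset.sum_ite_eq, Finset.mem_univ, if_true,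
    Set.indicator_apply, mem_rowEvent, bInd]
  by_cases hh : h (row4 (G.markedPartition ω ![a, b, c, d])) = true
  · simp [hh]
  · simp [hh]

/-- **The law form of a Theorem 2.1 kernel at `p` is twice `P(fgQ) P(Q) − P(fQ) P(gQ)`.** -/
theorem lawForm_kernel21_prob (S T : Finset (Fin 4)) (f g : Fin 15 → Bool) (p : E → ℝ)
    (a b c d : V) :
    ∑ s : Fin 15, ∑ t : Fin 15, (kernel21 S T f g s t : ℝ) *
        (G.law4 p a b c d s * G.law4 p a b c d t) =
      2 * (prob p (G.rowEvent ![a, b, c, d] fun s => f s && g s && sepRows S T s) *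
            prob p (G.rowEvent ![a, b, c, d] (sepRows S T)) -
          prob p (G.rowEvent ![a, b, c, d] fun s => f s && sepRows S T s) *
            prob p (G.rowEvent ![a, b, c, d] fun s => g s && sepRows S T s)) := by
  rw [lawForm_kernel21]
  simp only [← bInd_and, sum_bInd_mul_law4]

/-- **The law form of a Theorem 1.1 kernel at `p` is twice
`P(AB R_{X∩Y}) P(R_{X∪Y}) − P(A R_X) P(B R_Y)`.** -/
theorem lawForm_kernel11_prob (s : Fin 4) (A B : Fin 15 → Bool) (X Y : Finset (Fin 4)) (p : E → ℝ)
    (a b c d : V) :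
    ∑ q : Fin 15, ∑ r : Fin 15, (kernel11 s A B X Y q r : ℝ) *
        (G.law4 p a b c d q * G.law4 p a b c d r) =
      2 * (prob p (G.rowEvent ![a, b, c, d] fun q => A q && B q && sepFromRows s (X ∩ Y) q) *
            prob p (G.rowEvent ![a, b, c, d] (sepFromRows s (X ∪ Y))) -
          prob p (G.rowEvent ![a, b, c, d] fun q => A q && sepFromRows s X q) *
            prob p (G.rowEvent ![a, b, c, d] fun q => B q && sepFromRows s Y q)) := by
  rw [lawForm_kernel11]
  simp only [← bInd_and, sum_bInd_mul_law4]

end MultiGraph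

/-! ### The printed theorems from the class level -/

/-- **vdBHK Theorem 2.1 (`q = 1`) from `C024Thm21`**: for every admissible placement `(S, T, f, g)`, every finite
multigraph, every `p ∈ [0,1]^E` and every marks `a, b, c, d`: `P(f ∩ Q) · P(g ∩ Q) ≤ P(f ∩ g ∩ Q) · P(Q)`
(`Q = {S ↮ T}`; dividing by `P(Q)²` this is `E[fg | Q] ≥ E[f | Q] E[g | Q]`). -/
theorem vdBHK21_of_C024Thm21 (h : C024Thm21) (S T : Finset (Fin 4)) (hS : S.Nonempty)
    (hT : T.Nonempty) (hST : Disjoint S T) (f g : Fin 15 → Bool) (hf : IsMonoLit21 S T f)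
    (hg : IsMonoLit21 S T g) {V E : Type} [Fintype E] [DecidableEq E] (G : MultiGraph V E)
    {p : E → ℝ} (hp : IsProb p) (a b c d : V) :
    prob p (G.rowEvent ![a, b, c, d] fun s => f s && sepRows S T s) *
        prob p (G.rowEvent ![a, b, c, d] fun s => g s && sepRows S T s) ≤
      prob p (G.rowEvent ![a, b, c, d] fun s => f s && g s && sepRows S T s) *
        prob p (G.rowEvent ![a, b, c, d] (sepRows S T)) := by
  have h0 := G.lawForm_nonneg_of_classNonneg (K := fun s t => (kernel21 S T f g s t : ℝ))
    (h S T hS hT hST f g hf hg) hp a b c d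
  rw [G.lawForm_kernel21_prob] at h0
  linarith

/-- **vdBHK Theorem 1.1 from `C024Thm11`**: for every admissible placement `(s, A, B, X, Y)`, every finite
multigraph, every `p ∈ [0,1]^E` and every marks: `P(A ∩ R_X) · P(B ∩ R_Y) ≤ P(A ∩ B ∩ R_{X∩Y}) · P(R_{X∪Y})`. -/
theorem vdBHK11_of_C024Thm11 (h : C024Thm11) (s : Fin 4) (A B : Fin 15 → Bool)
    (hA : IsMonoStar11 s A) (hB : IsMonoStar11 s B) (X Y : Finset (Fin 4)) (hX : s ∉ X) (hY : s ∉ Y)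
    {V E : Type} [Fintype E] [DecidableEq E] (G : MultiGraph V E) {p : E → ℝ} (hp : IsProb p)
    (a b c d : V) :
    prob p (G.rowEvent ![a, b, c, d] fun q => A q && sepFromRows s X q) *
        prob p (G.rowEvent ![a, b, c, d] fun q => B q && sepFromRows s Y q) ≤
      prob p (G.rowEvent ![a, b, c, d] fun q => A q && B q && sepFromRows s (X ∩ Y) q) *
        prob p (G.rowEvent ![a, b, c, d] (sepFromRows s (X ∪ Y))) := by
  have h0 := G.lawForm_nonneg_of_classNonneg (K := fun q r => (kernel11 s A B X Y q r : ℝ))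
    (h s A B hA hB X Y hX hY) hp a b c d
  rw [G.lawForm_kernel11_prob] at h0
  linarith

open Classical in
/-- **The `V3` placement of `C024Thm21` is the C-002 inequality** (vdBHK Theorem 1.4, the cell's `C002`):
`S = {a}`, `T = {c}`, `f = [a ~ b]`, `g = [c ≁ d]` give
`P(a ~ b, a ≁ c) · P(c ≁ d, a ≁ c) ≤ P(a ~ b, c ≁ d, a ≁ c) · P(a ≁ c)`. -/
theorem C002_event_of_C024Thm21 (h : C024Thm21) {V E : Type} [Fintype E] [DecidableEq E]
    (G : MultiGraph V E) {p : E → ℝ} (hp : IsProb p) (a b c d : V) :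
    prob p (G.connEvent a b ∩ G.sepEvent a c) * prob p (G.sepEvent c d ∩ G.sepEvent a c) ≤
      prob p (G.connEvent a b ∩ G.sepEvent c d ∩ G.sepEvent a c) * prob p (G.sepEvent a c) := by
  have hf : IsMonoLit21 {0} {2} fun s => rowConn s 0 1 := isMonoLit21_conn (by decide)
  have hg : IsMonoLit21 {0} {2} fun s => !rowConn s 2 3 :=
    isMonoLit21_not_conn (by decide) (by decide)
  have key := vdBHK21_of_C024Thm21 h {0} {2} (by simp) (by simp) (by decide) _ _ hf hg G hp a b c d
  have hQ : G.rowEvent ![a, b, c, d] (sepRows {0} {2}) = G.sepEvent a c := by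
    rw [G.rowEvent_sepRows]
    ext ω
    simp [MultiGraph.sepEvent, MultiGraph.connEvent]
  have hab : G.rowEvent ![a, b, c, d] (fun s => rowConn s 0 1) = G.connEvent a b := by
    rw [G.rowEvent_rowConn]; rfl
  have hcd : G.rowEvent ![a, b, c, d] (fun s => !rowConn s 2 3) = G.sepEvent c d := by
    ext ω
    simp only [MultiGraph.mem_rowEvent, Bool.not_eq_true', MultiGraph.rowConn_row4_markedPartition,
      decide_eq_false_iff_not, MultiGraph.sepEvent, MultiGraph.connEvent]
    rfl
  simp only [MultiGraph.rowEvent_and, hQ, hab, hcd] at key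
  exact key

end PercRepro
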